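import Summits.MatrixMultiplication.OmegaCensus.SmallFormats.MatMul22nRankGF7Slack6FlatMain
import HarnessLib

/-!
# ω-census family (a): `decide`-checked facts of the slack-6 search tables — bitmaps flag every table key (part 5 of 8)

Cell `pub-omega` (unit `pub-omega-tensor-g18`, `pub-omega-tensor-g19`), topic `Summits/MatrixMultiplication/OmegaCensus` (sub-folder `SmallFormats`).
Framing (verbatim): lottery ticket; floor = certified bounds/negative ranges. HONEST FRAMING: machine-generated kernel checks
(`pub-omega-tensor-g19/code/py/gen6_keyfacts19.py`, from tensor g18's generator; replaces tensor g17's `…SearchFacts5`, whose single file exceeded the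
gate's 600 s): level 3, groups `≥ 8404`. Each fact is decided on the FLAT accessors (`MatMul22nRankGF7Slack6Flat1…7`, `…Slack6FlatMain`) with the linear quantifier
`allUpTo` and transported to the landed tables by the proved equalities `…F_eq`; the eight files are independent of one another (the per-level
`∀` statements `bmKeys6_L` are glued in `MatMul22nRankGF7Slack6SearchFinal`; levels with one part state theirs here). Consumed by `bm6_of_table` / `search6_sound` in
`MatMul22nRankGF7Slack6SearchFinal`. Nothing here is progress on `ω`.
-/

namespace Summit.MatrixMultiplication.OmegaCensus.SmallFormats

set_option Elab.async false

set_option maxRecDepth 100000 in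
set_option maxHeartbeats 400000000 in
/-- Level 3, groups `8404 ≤ g < 16807`, flat accessors: every table key is flagged by the bitmap (Boolean form). -/
theorem bmKeysB6_3bF : (allUpTo 8403 fun g => allUpTo (goff6F 3 ((8404 + g) + 1) - goff6F 3 (8404 + g)) fun t => bm6F 3 (((8404 + g) * k6LoMod 3 + low6F 3 (goff6F 3 (8404 + g) + t)) % 2 ^ bmb6 3) == 1) = true := by
  decide +kernel

/-- Level 3, groups `8404 ≤ g < 16807`: the same on the landed accessors. -/
theorem bmKeysB6_3b : (allUpTo 8403 fun g => allUpTo (goff6 3 ((8404 + g) + 1) - goff6 3 (8404 + g)) fun t => bm6 3 (((8404 + g) * k6LoMod 3 + low6 3 (goff6 3 (8404 + g) + t)) % 2 ^ bmb6 3) == 1) = true := by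
  simpa only [goff6F_eq, low6F_eq, bm6F_eq] using bmKeysB6_3bF

end Summit.MatrixMultiplication.OmegaCensus.SmallFormats
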